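import Mathlib
import Summits.NavierStokesRegularity.NavierStokesRegularity.Theorems.TaoLadderRungTwoBreakOneShiftMapDefs
import HarnessLib

/-!
# The one-shift map on trajectory space — the invariant set with time-Lipschitz tails and the raw
# (pre-clamp) block outputs (cell harvest/h2-tao-ladder, seat p2; kernel STAGE 3, rung1/KERNEL-STAGE3-PLAN.md;
# support for K1(1) = `NoSurvivingDSSOne`, stmt-NavierStokesRegularity-20205)

MODEL lattice ODEs only; nothing here is a statement about the Navier–Stokes equations; nothing is asserted —
definitions only, continuing `…OneShiftMapDefs` (p620787).

Why a second invariant set: the window block reads the top tail AT THE FLIGHT TIME `τ` (`g(z)·T_{i,W}(τ) =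
y_{i,W-1}`) and the wake block reads `T_{i,k+1}(τ)`; for the map to be Lipschitz in `τ` the tail
trajectories must be Lipschitz in time. Genuine lattice trajectories are (their rates are bounded on the
tubes), and the Picard–shift image of any admissible point is, so the natural complete invariant set is
`AdmLip R` = `Adm` ∩ {every tail shell `k` is `R k`-Lipschitz in time on the flight}. `rawWindow` /
`rawTailScaled` are the block outputs BEFORE the post-clamp (the objects the engine's Lipschitz constants and
STAGE 2's self-map inequalities speak about); `oneShiftMap` is their clamped version.
-/

noncomputable section

-- `Summit.NavierStokesRegularity.NavierStokesRegularity.…` is the tree's (summit = problem) namespace; the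
-- duplicated component is intended, so the dupNamespace linter is silenced for this file.
set_option linter.dupNamespace false

namespace Summit.NavierStokesRegularity.NavierStokesRegularity.Theorems

namespace DSSOneShift

open Set MeasureTheory intervalIntegral
open Literature.Analysis.FluidPDE Literature.Analysis.FluidPDE.TaoCascade CertificateGlueOn

variable {m : ℕ}

namespace OneShiftFrame

variable (F : OneShiftFrame m)

/-- **Admissible points with time-Lipschitz tails**: `Adm` and, for every tail shell `k` and mode `i`,
`|T_{i,k}(t) - T_{i,k}(s)| ≤ R_k |t - s|` on the flight (`R` = rate bounds of the lattice field on the tubes).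
[cite: Tao2016AveragedNS, §4 Lemma 4.1 (4.5)/(4.8) (a priori bounds ⟹ bounded rates); cell vocabulary, harvest/h2-tao-ladder rung1/STAGE2-LEMMA.md §3 Lemma 5, rung1/KERNEL-STAGE3-PLAN.md §1] -/
def AdmLip (R : ℤ → ℝ) (u : F.Space) : Prop :=
  F.Adm u ∧ ∀ i k, ¬ F.InWindow k → ∀ s ∈ Icc 0 F.τhi, ∀ t ∈ Icc 0 F.τhi,
    |F.decodeTail u i k t - F.decodeTail u i k s| ≤ R k * |t - s|

/-- The same set WITHOUT the (redundant) continuity clause of `Adm` — every clause is a pointwise closed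
condition, which is how completeness is proved; time-Lipschitz tails are continuous.
[folklore] -/
def AdmLip' (R : ℤ → ℝ) (u : F.Space) : Prop :=
  (∀ i k, |u.1 i k| ≤ 1) ∧ |u.2.1| ≤ 1 ∧
  (∀ i k, ¬ F.InWindow k → ∀ t ∈ Icc 0 F.τhi, |F.decodeTail u i k t - F.tubeC i k| ≤ F.tubeR k) ∧
  (∀ i k, F.InWindow k → ∀ t : Icc (0 : ℝ) F.τhi, (u.2.2 : F.TailIdx → ℝ) (i, k, t) = 0) ∧
  (∀ i k, ¬ F.InWindow k → ∀ s ∈ Icc 0 F.τhi, ∀ t ∈ Icc 0 F.τhi,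
    |F.decodeTail u i k t - F.decodeTail u i k s| ≤ R k * |t - s|)

/-- **Raw window output** (scaled, before the post-clamp): the Krawczyk map on the pre-clamped data,
re-scaled to the unit box coordinates. `(oneShiftMap cert u).1 = clampUnit ∘ (rawWindow cert u).1` etc.
[cite: Tao2016AveragedNS, §5.3; cell vocabulary, harvest/h2-tao-ladder rung1/STAGE2-LEMMA.md §2 (N = x - C·G)] -/
def rawWindow {ε₀ : ℝ} {α : Fin m → Fin m → Fin m → ℤ × ℤ × ℤ → ℝ}
    (cert : OneShiftWindowCert F ε₀ α) (u : F.Space) : (Fin m → Fin F.W → ℝ) × ℝ :=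
  let out := cert.Nmap (F.preclampTail u) (F.preclampY u, F.preclampTau u)
  (fun i k => (out.1 i (k : ℤ) - F.yc i k) / F.a i k, (out.2 - F.τc) / F.rτ)

/-- **Raw scaled tail output** (before the post-clamp): `tailRaw / wt` at a tail index.
[cite: Tao2016AveragedNS, §4; cell vocabulary, harvest/h2-tao-ladder rung1/KERNEL-STAGE3-PLAN.md §1] -/
def rawTailScaled {ε₀ : ℝ} {α : Fin m → Fin m → Fin m → ℤ × ℤ × ℤ → ℝ}
    (cert : OneShiftWindowCert F ε₀ α) (u : F.Space) (p : F.TailIdx) : ℝ :=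
  F.tailRaw cert u p.1 p.2.1 (p.2.2 : ℝ) / F.wt p.2.1

/-- Unfolding: the window block of `oneShiftMap` is the clamped raw window output. [folklore] -/
theorem oneShiftMap_fst {ε₀ : ℝ} {α : Fin m → Fin m → Fin m → ℤ × ℤ × ℤ → ℝ}
    (cert : OneShiftWindowCert F ε₀ α) (u : F.Space) (i : Fin m) (k : Fin F.W) :
    (F.oneShiftMap cert u).1 i k = clampUnit ((F.rawWindow cert u).1 i k) := rfl

/-- Unfolding: the flight-time coordinate of `oneShiftMap` is the clamped raw one. [folklore] -/
theorem oneShiftMap_snd_fst {ε₀ : ℝ} {α : Fin m → Fin m → Fin m → ℤ × ℤ × ℤ → ℝ}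
    (cert : OneShiftWindowCert F ε₀ α) (u : F.Space) :
    (F.oneShiftMap cert u).2.1 = clampUnit (F.rawWindow cert u).2 := rfl

/-- Unfolding: the tail block of `oneShiftMap` is the clamped raw scaled tail output. [folklore] -/
theorem oneShiftMap_snd_snd_apply {ε₀ : ℝ} {α : Fin m → Fin m → Fin m → ℤ × ℤ × ℤ → ℝ}
    (cert : OneShiftWindowCert F ε₀ α) (u : F.Space) (p : F.TailIdx) :
    ((F.oneShiftMap cert u).2.2 : F.TailIdx → ℝ) p = F.clampTail p.1 p.2.1 (F.rawTailScaled cert u p) :=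
  rfl

end OneShiftFrame

end DSSOneShift

end Summit.NavierStokesRegularity.NavierStokesRegularity.Theorems
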